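import Mathlib
import Summits.Ventures.PercRepro2.SwOutMultiRootIneq
import Summits.Ventures.PercRepro2.SwOutMultiRootBase

/-!
# THE MULTI-ROOT CORE CUBE THEOREM: the non-escaping part of a class with any set of junctions
(blind cell PercRepro2, night-4 g34, 2026-08-29; proofs/NIGHT4-G34.md §6)

A region `U ∋ h`, `l ∉ U`, a set `R ∋ h` of ROOTS inside `U` (the junctions with `h`; no edge joins
two roots, no loop at a root), every other vertex of `U` exempt (forced into `C_R(l)` by `𝓤`), in `X`
(loops only; `X` avoids `R`), with an outside edge, or isolated.  THE NON-ESCAPING PART of the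
general doubly typed side of a class `(U, ξ)` — the side points at which the hull of every root
lies inside `U` — is partitioned by the multi-root core cubes (key = the base and the arms,
`baseR` / `armsR`; block = g13's `coreCube` of that base; SwOutMultiRootKinds / Sides / Base), every cube lies in the part and carries
the key (SwOutMultiRootKinds), and the rigid counting inequality holds on every cube
(SwOutMultiRootIneq): **`rigidOK_g_of_multiRoot`** — the rigid counting inequality on the
non-escaping part, by the block decomposition of a part (`rigidOK_g_of_blocks_part`).

This is the core-kind half of the merger NIGHT4-G33.md §8 (a) asked for — for ANY set of
junctions (adjacent junctions after g29's subdivision of the edge, mixed junctions included), with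
no hypothesis on the neighbourhoods of the junctions at all: census 3,127 cubes / 4,621 points on
the 364 uncovered mark-step classes at `n = 6` without a blue-escaping junction, 0 failures
(mining/night-4/g34/mrcube.py).  The escaping parts are the successor's (NIGHT4-G34.md §7).
-/

namespace Summit.Ventures.PercRepro2

namespace LocRows

open Hull

variable {V : Type*} {E : Type*} [Fintype E] [DecidableEq E]

open scoped Classical

variable {ends : E → Sym2 V} {U : Set V} {ξ : Config E} {l h : V}
  {𝓤 𝓓 𝓓'' : Set (Set V)} {X : Set V} {𝓤' : Set (Set V)} {F : V → Prop}

section Blocks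

/-- **The rigid inequality on a part from a block decomposition of the part**: blocks are only
required for the side points of the part `P`, every side point of such a block lies in the part
with the same key, and every block satisfies the inequality. -/
theorem rigidOK_g_of_blocks_part {K : Type*} (key : Config E → K) (block : K → Finset (Config E))
    (P : Config E → Prop)
    (hmem : ∀ ζ ∈ gOutSide ends l h 𝓤 𝓓 𝓓'' X 𝓤' U ξ, P ζ → ζ ∈ block (key ζ))
    (hblock : ∀ ζ ∈ gOutSide ends l h 𝓤 𝓓 𝓓'' X 𝓤' U ξ, P ζ → ∀ ζ' ∈ block (key ζ),
      ζ' ∈ gTypedQ ends l h 𝓤 𝓓 𝓓'' X 𝓤' →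
        ζ' ∈ gOutSide ends l h 𝓤 𝓓 𝓓'' X 𝓤' U ξ ∧ P ζ' ∧ key ζ' = key ζ)
    (hineq : ∀ ζ ∈ gOutSide ends l h 𝓤 𝓓 𝓓'' X 𝓤' U ξ, P ζ → ∀ 𝓔 : Set (Set E), IsUpperSet 𝓔 →
      ((block (key ζ)).filter fun ζ' =>
          ζ' ∈ gTypedQ ends l h 𝓤 𝓓 𝓓'' X 𝓤' ∧ redEdges ends ζ' h ∈ 𝓔).card ≤
        ((block (key ζ)).filter fun ζ' =>
          ζ' ∈ gTypedQ ends l h 𝓤 𝓓 𝓓'' X 𝓤' ∧ blueEdges ends ζ' h ∈ 𝓔).card)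
    {𝓔 : Set (Set E)} (h𝓔 : IsUpperSet 𝓔) :
    ((gOutSide ends l h 𝓤 𝓓 𝓓'' X 𝓤' U ξ).filter fun ζ => P ζ ∧ redEdges ends ζ h ∈ 𝓔).card ≤
      ((gOutSide ends l h 𝓤 𝓓 𝓓'' X 𝓤' U ξ).filter fun ζ => P ζ ∧ blueEdges ends ζ h ∈ 𝓔).card := by
  set C := gOutSide ends l h 𝓤 𝓓 𝓓'' X 𝓤' U ξ with hC
  let S₀ : Finset K := (C.filter fun ζ => P ζ).image key
  have hmapR : ∀ ζ ∈ C.filter fun ζ => P ζ ∧ redEdges ends ζ h ∈ 𝓔, key ζ ∈ S₀ := fun ζ hζ =>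
    Finset.mem_image_of_mem key
      (Finset.mem_filter.2 ⟨(Finset.mem_filter.1 hζ).1, (Finset.mem_filter.1 hζ).2.1⟩)
  have hmapB : ∀ ζ ∈ C.filter fun ζ => P ζ ∧ blueEdges ends ζ h ∈ 𝓔, key ζ ∈ S₀ := fun ζ hζ =>
    Finset.mem_image_of_mem key
      (Finset.mem_filter.2 ⟨(Finset.mem_filter.1 hζ).1, (Finset.mem_filter.1 hζ).2.1⟩)
  rw [Finset.card_eq_sum_card_fiberwise hmapR, Finset.card_eq_sum_card_fiberwise hmapB]
  refine Finset.sum_le_sum fun k hk => ?_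
  obtain ⟨ζ₀, hζ₀, rfl⟩ := Finset.mem_image.1 hk
  rw [Finset.mem_filter] at hζ₀
  have hfib : ∀ (P' : Config E → Prop) [DecidablePred P'],
      (C.filter fun ζ => P ζ ∧ P' ζ).filter (fun ζ => key ζ = key ζ₀) =
        (block (key ζ₀)).filter fun ζ' => ζ' ∈ gTypedQ ends l h 𝓤 𝓓 𝓓'' X 𝓤' ∧ P' ζ' := by
    intro P' _
    ext ζ'
    simp only [Finset.mem_filter]
    constructor
    · rintro ⟨⟨hζ', hP, hP'⟩, hkey⟩
      have := hmem ζ' hζ' hP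
      rw [hkey] at this
      exact ⟨this, (mem_gOutSide.1 hζ').1, hP'⟩
    · rintro ⟨hb, hQ, hP'⟩
      obtain ⟨hcl, hP, hkey⟩ := hblock ζ₀ hζ₀.1 hζ₀.2 ζ' hb hQ
      exact ⟨⟨hcl, hP, hP'⟩, hkey⟩
  rw [hfib (fun ζ => redEdges ends ζ h ∈ 𝓔), hfib (fun ζ => blueEdges ends ζ h ∈ 𝓔)]
  exact hineq ζ₀ hζ₀.1 hζ₀.2 𝓔 h𝓔

end Blocks

section Main

variable {R : Set V}

omit [Fintype E] [DecidableEq E] in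
/-- The vertices of `X` lie outside the extended hull (`X` avoids the roots, its vertices carry
loops only). -/
lemma X_notMem_extHullR (hRX : ∀ r ∈ R, r ∉ X) {ζ : Config E} (hne : ∀ r ∈ R, hull ends ζ r ⊆ U)
    (hX : ∀ x ∈ X, x ∈ U → ∀ e, x ∈ ends e → ends e = s(x, x)) {x : V} (hx : x ∈ X) :
    x ∉ extHullR ends R ζ := by
  rintro ⟨r, hr, hxr⟩
  have hxU : x ∈ U := hne r hr hxr
  have hxr' : x ≠ r := fun h' => hRX r hr (h' ▸ hx)
  rcases hxr with h' | h'
  · exact notMem_cluster_of_selfLoops hxr' (hX x hx hxU) h'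
  · exact notMem_cluster_of_selfLoops hxr' (hX x hx hxU) h'

variable (h𝓤 : IsUpperSet 𝓤) (h𝓓 : IsLowerSet 𝓓) (h𝓓'' : IsLowerSet 𝓓'') (h𝓤' : IsUpperSet 𝓤')
  (hl : l ∉ U) (hh : h ∈ R)
  (hroot : ∀ e r x, r ∈ R → ends e = s(r, x) → x ∉ R)
  (hF : ∀ x, F x → ∀ S ∈ 𝓤, x ∈ S)
  (hout : ∀ x ∈ U, x ∉ R →
    F x ∨ x ∈ X ∨ (∃ e y, ends e = s(x, y) ∧ y ∉ U) ∨ (∀ e, x ∉ ends e))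
  (hX : ∀ x ∈ X, x ∈ U → ∀ e, x ∈ ends e → ends e = s(x, x))
  (hRX : ∀ r ∈ R, r ∉ X)
include hl hh hroot hF hout hX

/-- The base of a non-escaping side point lies in the class. -/
lemma baseR_mem_outClass {ζ : Config E} (hζ : ζ ∈ gOutSide ends l h 𝓤 𝓓 𝓓'' X 𝓤' U ξ)
    (hne : ∀ r ∈ R, hull ends ζ r ⊆ U) : baseR ends R ζ ∈ outClass ends U h ξ := by
  have hb := multiBase_baseR hl hroot hF hout hX hζ hne
  have hcl := (mem_gOutSide.1 hζ).2
  rw [mem_outClass] at hcl ⊢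
  refine ⟨fun e he => ?_, ?_⟩
  · rw [← hcl.1 e he]
    unfold baseR
    rw [flip_apply_of_notMem]
    rintro ⟨x, hx, y, hxy⟩
    exact he ⟨x, extHullR_subset_U hne (bluePartR_subset hx), y, hxy⟩
  · have := hb.hull_subset (fun _ => true) hh
    rw [MultiBase.coreReal_top] at this
    exact this.trans (extHullR_subset_U hne)

include h𝓤 h𝓓 h𝓓'' h𝓤' hRX in
/-- **THE MULTI-ROOT CORE CUBE THEOREM**: the rigid counting inequality on the NON-ESCAPING part
of the general doubly typed side of every class of a region with the roots `R ∋ h`. -/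
theorem rigidOK_g_of_multiRoot {𝓔 : Set (Set E)} (h𝓔 : IsUpperSet 𝓔) :
    ((gOutSide ends l h 𝓤 𝓓 𝓓'' X 𝓤' U ξ).filter fun ζ =>
        (∀ r ∈ R, hull ends ζ r ⊆ U) ∧ redEdges ends ζ h ∈ 𝓔).card ≤
      ((gOutSide ends l h 𝓤 𝓓 𝓓'' X 𝓤' U ξ).filter fun ζ =>
        (∀ r ∈ R, hull ends ζ r ⊆ U) ∧ blueEdges ends ζ h ∈ 𝓔).card := by
  refine rigidOK_g_of_blocks_part (fun ζ => (baseR ends R ζ, armsR ends R ζ))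
    (fun p => coreCube ends (armsFun p.2) p.1) (fun ζ => ∀ r ∈ R, hull ends ζ r ⊆ U) ?_ ?_ ?_ h𝓔
  · -- every non-escaping side point is the cube point `omegaR` of its base
    intro ζ hζ hne
    exact mem_coreCube.2 ⟨omegaR ends R ζ, coreReal_baseR_omegaR hl hF hout hX hζ hne⟩
  · -- every side point of the cube lies in the part with the same key
    intro ζ hζ hne ζ' hζ' hQ
    have hb := multiBase_baseR hl hroot hF hout hX hζ hne
    obtain ⟨ω, rfl⟩ := mem_coreCube.1 hζ'
    have hHU : extHullR ends R ζ ⊆ U := extHullR_subset_U hne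
    have hH : extHullR ends R (baseR ends R ζ) = extHullR ends R ζ := by
      have := hb.extHullR_coreReal (fun _ => true)
      rwa [MultiBase.coreReal_top] at this
    refine ⟨mem_gOutSide.2 ⟨hQ, hb.coreReal_mem_outClass hh hHU
      (baseR_mem_outClass hl hh hroot hF hout hX hζ hne) ω⟩,
      fun r hr => hb.hull_coreReal_subset_U hHU ω hr, ?_⟩
    simp only
    rw [hb.baseR_coreReal ω, hb.armsR_coreReal ω hH, armsR_congr hH]
  · -- the inequality on every cube
    intro ζ hζ hne 𝓔' h𝓔'
    have hb := multiBase_baseR hl hroot hF hout hX hζ hne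
    exact hb.card_coreCube_le_g hh h𝓤 h𝓓 h𝓓'' h𝓤' (extHullR_subset_U hne) hl
      (fun x hx => X_notMem_extHullR hRX hne hX hx) h𝓔'

end Main

end LocRows

end Summit.Ventures.PercRepro2
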